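import Literature.IUT.HodgeTheaters.PMBaseNegCompatSyncProofs

/-!
# [IUTchI] Ex 6.3 (i)/(ii): criteria for an automorphism of `𝒟^{⊚±}` to be a lift of `[−1] = (0, −1) ∈ 𝔽_l^{⋊±}`, and
# the `[−1]`-compatibility law (β) from fixed-point data (proof-only; shaped for the genuine-kit binding)

S. Mochizuki, *Inter-universal Teichmüller theory I*, kurims manuscript (May 2020), §6: Def 6.1 (v) p. 158
("the natural surjective homomorphism `Aut(𝒟^{⊚±}) ↠ 𝔽_l^⋇` … kernel `Aut_±(𝒟^{⊚±})`"; "the cusp `ε` determines … a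
natural `𝔽_l^±`-torsor structure on `LabCusp^±(𝒟^{⊚±})`"; "`Aut_K(X̲_K) ⥲ Aut_±(𝒟^{⊚±})/Aut_csp(𝒟^{⊚±}) ⥲ 𝔽_l^{⋊±}`"),
Example 6.3 (i) p. 160 (the FIXED chart `LabCusp^±(𝒟^{⊚±}) ⥲ 𝔽_l`), (ii) p. 161 ("`φ^{Θell}_±` is equivariant")
([IUTchI] Ex 6.3 (ii) p.161) [claim: Mochizuki2012, status: disputed] (D-0012 claim key, series status DISPUTED;
nothing of the series is asserted; no side is taken on [IUTchIII] Cor. 3.12).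

PROOF-ONLY companion (abc-iut-L5-t13, the (β) discharge lineage: `PMBaseEx63Proofs` p410816,
`PMBaseNegCompatSyncProofs` p420660) over abc-iut-L5-t4's `PMBaseKit` / `Ex63.lifts` and abc-iut-w5-d086's
`Ex63.NegCompatModel`.  PURPOSE (KIT-INSTANCE-SPEC P5-binding, abc-iut-L5-lead RULINGS #28 (1) / GAP G-L5d3g5-1):
after p420660 the laws (α)/(β) of the §6 cone rows reduce to «at each `v` some `a ∈ Aut(𝒟_v)` and some LIFT
`b ∈ Aut_±(𝒟^{⊚±})` of `(0,−1)` with `a ≫ φ^{Θell}_{•,v} = φ^{Θell}_{•,v} ≫ b`»; abc-iut-L5-t4's p422024/PiAvatarBinding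
supply, at the genuine data (good `v̲`), automorphisms `a`, `b` with the square ON THE NOSE.  What remains for the
binding is `b ∈ Ex63.lifts K (0,−1)`.  This file turns that membership into FIXED-POINT data:

* `Ex63.mem_lifts_iff_gChart₀` — `b ∈ lifts K γ` iff `b ∈ Aut_±(𝒟^{⊚±})` and `b` acts on `LabCusp^±(𝒟^{⊚±})`, read in
  the fixed chart, as `γ`;
* `Ex63.mem_lifts_zero_negOne_of_fixes` — **an element `b ∈ Aut_±(𝒟^{⊚±})` that MOVES some `±`-label class but FIXES
  the class of chart-value `0` (the cusp `ε`) is a lift of `(0, −1)`**: by the interface clause `gLab_range`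
  (Def 6.1 (v)/Prop 6.5 (iv)) `b` acts as some `(c, ε′) ∈ 𝔽_l^{⋊±}`; fixing `0` forces `c = 0`, moving something
  forces `ε′ = −1`.  No hypothesis on `l`;
* `Ex63.gLabMap_ne_refl_of_commutes` — in a commuting square `a ≫ φ^{Θell}_{•,v} = φ^{Θell}_{•,v} ≫ b`, if `a` is
  NEGATIVE (moves a label class of `𝒟_v`) then `b` moves a label class of `𝒟^{⊚±}` (the square on labels,
  `labOfHom_phiEll_comp_labMap`, and injectivity of the bijection induced by `φ^{Θell}_{•,v}`);
* **`Ex63.negCompatModel_of_fixes`** / **`…_of_fixes_of_negative`** — (β) `Ex63.NegCompatModel K` (hence (α), Prop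
  6.5 (i) s.2, 6.6 (ii)(iii), 6.8 (i), Rmk 6.12.1 by the landed theorems), for `l` an odd prime, from: at each `v`,
  `a ∈ Aut(𝒟_v)`, `b ∈ Aut_±(𝒟^{⊚±})` fixing the `ε`-class, the square, and EITHER «`b` moves a class of `𝒟^{⊚±}`» OR
  «`a` moves a class of `𝒟_v`» — the shape in which the Π-avatar binding produces its involutions.

Proof-only (no definitions, no `Prop` facts); typed ≠ proved elsewhere.
-/

namespace Literature.IUT.HodgeTheaters

open CategoryTheory

universe u

namespace PMBaseKit

variable {l : ℕ} {K : PMBaseKit.{u} l}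

namespace Ex63

/-- **Lifts, read in the fixed chart** ([IUTchI] Ex 6.3 (i) p. 161): `b ∈ Aut(𝒟^{⊚±})` is a lift of `γ ∈ 𝔽_l^{⋊±}`
iff `b ∈ Aut_±(𝒟^{⊚±})` and `LabCusp^±(b)` is `γ` in the fixed chart `LabCusp^±(𝒟^{⊚±}) ⥲ 𝔽_l`.
[claim: Mochizuki2012, status: disputed] -/
theorem mem_lifts_iff_gChart₀ (γ : FlPM l) (b : Aut K.gModel) :
    b ∈ lifts K γ ↔ b ∈ K.autPMg K.gModel ∧ ∀ g, K.gChart₀ (K.gLabMap b g) = γ • K.gChart₀ g := by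
  constructor
  · rintro ⟨hb, he⟩
    refine ⟨hb, fun g => ?_⟩
    rw [he]
    simp
  · rintro ⟨hb, he⟩
    refine ⟨hb, ?_⟩
    ext g
    rw [Equiv.trans_apply, Equiv.trans_apply, FlPM.toPerm_apply, ← he, Equiv.symm_apply_apply]

/-- How an element of `Aut_±(𝒟^{⊚±})` acts on `±`-label classes, read in the fixed chart: as SOME element of
`𝔽_l^{⋊±}` (interface clause `gLab_range` = [IUTchI] Def 6.1 (v) p. 158 "`Aut_±(𝒟^{⊚±})/Aut_csp(𝒟^{⊚±}) ⥲ 𝔽_l^{⋊±}`",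
Prop 6.5 (iv) p. 165). [claim: Mochizuki2012, status: disputed] -/
theorem exists_flPM_of_mem_autPMg {b : Aut K.gModel} (hb : b ∈ K.autPMg K.gModel) :
    ∃ γ : FlPM l, ∀ g, K.gChart₀ (K.gLabMap b g) = γ • K.gChart₀ g := by
  have hPM : (K.gLabMap b : Equiv.Perm (K.GLab K.gModel)) ∈ K.gLabT.autPM :=
    (K.gLab_range _).2 ⟨b, (K.mem_autPMg_iff b).1 hb, rfl⟩
  exact hPM K.gChart₀ K.gChart₀_mem

/-- **Fixed-point criterion for lifting `[−1]`** ([IUTchI] Def 6.1 (v) p. 158 / Ex 6.3 (i) p. 161): an element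
`b ∈ Aut_±(𝒟^{⊚±})` which FIXES the `±`-label class of chart-value `0` (the class of the cusp `ε`, Def 6.1 (v)) and
MOVES some `±`-label class is a lift of `(0, −1) ∈ 𝔽_l^{⋊±}`.  Proof: `b` acts as `x ↦ ε′x + c`; `x = 0` fixed gives
`c = 0`; `ε′ = 1` would make the action trivial.  No hypothesis on `l`. [claim: Mochizuki2012, status: disputed] -/
theorem mem_lifts_zero_negOne_of_fixes {b : Aut K.gModel} (hb : b ∈ K.autPMg K.gModel)
    (hfix : K.gLabMap b (K.gChart₀.symm 0) = K.gChart₀.symm 0)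
    (hne : K.gLabMap b ≠ Equiv.refl _) : b ∈ lifts K (FlPM.mk 0 (-1)) := by
  rw [mem_lifts_iff_gChart₀]
  refine ⟨hb, ?_⟩
  obtain ⟨γ, hγ⟩ := exists_flPM_of_mem_autPMg hb
  -- the translation part vanishes: evaluate at the class of chart-value `0`
  have hc : γ.left.toAdd = 0 := by
    have h0 := hγ (K.gChart₀.symm 0)
    rw [hfix, Equiv.apply_symm_apply, FlPM.smul_def, smul_zero, zero_add] at h0
    exact h0.symm
  -- the sign is `−1`: otherwise `b` acts trivially
  have hε : γ.right = -1 := by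
    rcases Int.units_eq_one_or γ.right with h1 | h1
    · exfalso
      apply hne
      ext g
      apply K.gChart₀.injective
      rw [hγ g, FlPM.smul_def, h1, hc, one_smul, add_zero, Equiv.refl_apply]
    · exact h1
  intro g
  rw [hγ g, FlPM.smul_def, FlPM.mk_smul, hε, hc]

/-- **A negative `a` forces `b` to move a label class** ([IUTchI] Ex 6.3 (ii) p. 161 read on `±`-label classes):
in a commuting square `a ≫ φ^{Θell}_{•,v} = φ^{Θell}_{•,v} ≫ b`, `ζ ∘ LabCusp^±(a) = LabCusp^±(b) ∘ ζ` with `ζ` the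
bijection induced by `φ^{Θell}_{•,v}`; so if `LabCusp^±(a) ≠ 1` then `LabCusp^±(b) ≠ 1`. [claim: Mochizuki2012, status: disputed] -/
theorem gLabMap_ne_refl_of_commutes {v : K.V} {a : K.model v ≅ K.model v} {b : Aut K.gModel}
    (h : a.hom ≫ K.phiEll v = K.phiEll v ≫ (K.atV v).map b.hom) (ha : K.labMap v a ≠ Equiv.refl _) :
    K.gLabMap b ≠ Equiv.refl _ := by
  intro hb
  apply ha
  have hconj := labOfHom_phiEll_comp_labMap h
  rw [hb] at hconj
  ext x
  apply (K.labOfHom_phiEll_bijective v).1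
  have := congrFun hconj x
  simpa using this

/-- **(β) from fixed-point data** ([IUTchI] Ex 6.3 (ii) p. 161, for `l` an odd prime): if at every `v ∈ 𝕍` there are
an automorphism `a` of `𝒟_v` and an element `b ∈ Aut_±(𝒟^{⊚±})` fixing the `ε`-class and moving some `±`-label class
of `𝒟^{⊚±}`, with `a ≫ φ^{Θell}_{•,v} = φ^{Θell}_{•,v} ≫ b`, then `Ex63.NegCompatModel K` — whence (α) `PhiEllSync`
(`phiEllSync_of_negCompatModel`) and the β-family of §6 rows by the landed `_of_negCompatModel` theorems.
[claim: Mochizuki2012, status: disputed] -/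
theorem negCompatModel_of_fixes [Fact l.Prime] (hl : l ≠ 2)
    (h : ∀ v, ∃ (a : K.model v ≅ K.model v) (b : Aut K.gModel),
      b ∈ K.autPMg K.gModel ∧ K.gLabMap b (K.gChart₀.symm 0) = K.gChart₀.symm 0 ∧
        K.gLabMap b ≠ Equiv.refl _ ∧ a.hom ≫ K.phiEll v = K.phiEll v ≫ (K.atV v).map b.hom) :
    NegCompatModel K :=
  negCompatModel_of_commutes hl fun v => by
    obtain ⟨a, b, hb, hfix, hne, hsq⟩ := h v
    exact ⟨a, b, mem_lifts_zero_negOne_of_fixes hb hfix hne, hsq⟩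

/-- **(β) from fixed-point data, local form of the non-triviality** ([IUTchI] Ex 6.3 (ii) p. 161, `l` an odd
prime): as `negCompatModel_of_fixes`, with «`b` moves a class of `𝒟^{⊚±}`» replaced by «`a` is NEGATIVE, i.e. moves a
class of `𝒟_v`» (Def 6.1 (iii): `a ∈ Aut_−(𝒟_v)`). [claim: Mochizuki2012, status: disputed] -/
theorem negCompatModel_of_fixes_of_negative [Fact l.Prime] (hl : l ≠ 2)
    (h : ∀ v, ∃ (a : K.model v ≅ K.model v) (b : Aut K.gModel),
      b ∈ K.autPMg K.gModel ∧ K.gLabMap b (K.gChart₀.symm 0) = K.gChart₀.symm 0 ∧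
        K.labMap v a ≠ Equiv.refl _ ∧ a.hom ≫ K.phiEll v = K.phiEll v ≫ (K.atV v).map b.hom) :
    NegCompatModel K :=
  negCompatModel_of_fixes hl fun v => by
    obtain ⟨a, b, hb, hfix, hne, hsq⟩ := h v
    exact ⟨a, b, hb, hfix, gLabMap_ne_refl_of_commutes hsq hne, hsq⟩

/-- Conversely, every lift of `(0, −1)` fixes the `ε`-class and (for `2 < l`) moves some class — so the
fixed-point criterion is sharp ([IUTchI] Ex 6.3 (i) p. 161). [claim: Mochizuki2012, status: disputed] -/
theorem fixes_of_mem_lifts_zero_negOne {b : Aut K.gModel} (hb : b ∈ lifts K (FlPM.mk 0 (-1))) :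
    K.gLabMap b (K.gChart₀.symm 0) = K.gChart₀.symm 0 := by
  apply K.gChart₀.injective
  rw [gChart₀_gLabMap_of_mem_lifts hb, Equiv.apply_symm_apply, neg_zero]

/-- … and moves the class of chart-value `1` when `2 < l`. [claim: Mochizuki2012, status: disputed] -/
theorem gLabMap_ne_refl_of_mem_lifts_zero_negOne [Fact (2 < l)] {b : Aut K.gModel}
    (hb : b ∈ lifts K (FlPM.mk 0 (-1))) : K.gLabMap b ≠ Equiv.refl _ := by
  intro h
  have key := gChart₀_gLabMap_of_mem_lifts hb (K.gChart₀.symm 1)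
  rw [h, Equiv.refl_apply, Equiv.apply_symm_apply] at key
  exact ZMod.neg_one_ne_one key.symm

end Ex63

end PMBaseKit

end Literature.IUT.HodgeTheaters
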